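import Literature.NumberTheory.LFunctions.PrimeSumSmoothWeight
import HarnessLib

/-!
# Prime sums with the weights `1/log t`, `1/(t log t)`, `t/log² t`

Topic `Literature/NumberTheory/LFunctions`. Everything here is PROVED. Three instances of
`Literature.NumberTheory.LFunctions.abs_sum_prime_mul_log_sub_integral_le` (Abel summation through
`ϑ`, file `PrimeSumSmoothWeight.lean`), valid for `e ≤ a ≤ b` and any `C ≥ 0` with
`|ϑ(t) − t| ≤ C t/log² t` for `t ≥ 2` (a PROVED consequence of the prime number theorem with the
de la Vallée Poussin error term, `Literature.NumberTheory.LFunctions.exists_abs_theta_sub_self_le_div_log_sq`):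

* `abs_card_primes_Ioc_sub_le` — `|#{⌊a⌋ < p ≤ ⌊b⌋} − (b/log b − a/log a)| ≤ (1 + 3C) b/log² a`;
* `sum_primes_Ioc_inv_le` — `∑_{⌊a⌋ < p ≤ ⌊b⌋} 1/p ≤ (1 + 2C) log b/log a + 2C`
  (a crude Mertens bound, enough when `log b ≍ log a`);
* `sum_primes_Ioc_div_log_le` — `∑_{⌊a⌋ < p ≤ ⌊b⌋} p/log p ≤ (1 + 5C) b²/log² a`.

Constants are not optimised. These are the prime-sum inputs of the rough-number asymptotics
`Literature/NumberTheory/Sieve/RoughNumbersBuchstab*.lean`.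

## References

* H. L. Montgomery, R. C. Vaughan, *Multiplicative Number Theory I. Classical Theory*, CUP 2007,
  §2.1 (Abel summation), Theorem 2.7 (Mertens). [MontgomeryVaughan2007]
-/

open Finset Real MeasureTheory Set intervalIntegral
open scoped Chebyshev

noncomputable section

namespace Literature.NumberTheory.LFunctions

section Weights

variable {a b C : ℝ}

/-- For `t ≥ e`: `t > 0`, `log t ≥ 1`. [folklore] -/
private theorem pos_and_one_le_log {t : ℝ} (ht : Real.exp 1 ≤ t) : 0 < t ∧ 1 ≤ Real.log t := by
  have ht0 : 0 < t := (Real.exp_pos 1).trans_le ht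
  exact ⟨ht0, by rw [Real.le_log_iff_exp_le ht0]; exact ht⟩

/-- **Primes in `(⌊a⌋, ⌊b⌋]`** (`e ≤ a ≤ b`): with `|ϑ(t) − t| ≤ C t/log² t`,
`|#{⌊a⌋ < p ≤ ⌊b⌋} − (b/log b − a/log a)| ≤ (1 + 3C) b/log² a`
(weight `1/log t`; `∫_a^b dt/log t = b/log b − a/log a + ∫_a^b dt/log² t` and
`0 ≤ ∫_a^b dt/log² t ≤ b/log² a`). [cite: MontgomeryVaughan2007, §2.1 (Abel summation)] -/
theorem abs_card_primes_Ioc_sub_le (ha : Real.exp 1 ≤ a) (hab : a ≤ b) (hC : 0 ≤ C)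
    (hE : ∀ t : ℝ, 2 ≤ t → |θ t - t| ≤ C * t / Real.log t ^ 2) :
    |(((Finset.Ioc ⌊a⌋₊ ⌊b⌋₊).filter Nat.Prime).card : ℝ) - (b / Real.log b - a / Real.log a)| ≤
      (1 + 3 * C) * b / Real.log a ^ 2 := by
  have hea : (2 : ℝ) ≤ a := le_trans (by have := Real.add_one_le_exp (1 : ℝ); linarith) ha
  obtain ⟨ha0, hla⟩ := pos_and_one_le_log ha
  have hmem : ∀ t ∈ Icc a b, 0 < t ∧ 1 ≤ Real.log t := fun t ht =>
    pos_and_one_le_log (ha.trans ht.1)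
  -- the weight and its derivative
  set f : ℝ → ℝ := fun t => (Real.log t)⁻¹ with hf_def
  set f' : ℝ → ℝ := fun t => -t⁻¹ / Real.log t ^ 2 with hf'_def
  have hf : ∀ t ∈ Icc a b, HasDerivAt f (f' t) t := fun t ht => by
    obtain ⟨ht0, hlt⟩ := hmem t ht
    exact (Real.hasDerivAt_log ht0.ne').inv (by linarith)
  have hf'c : ContinuousOn f' (Icc a b) := fun t ht => by
    obtain ⟨ht0, hlt⟩ := hmem t ht
    have h1 : t ≠ 0 := ht0.ne'
    have h2 : Real.log t ^ 2 ≠ 0 := pow_ne_zero 2 (by linarith)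
    refine ContinuousAt.continuousWithinAt ?_
    rw [hf'_def]
    fun_prop (disch := assumption)
  have hmain := abs_sum_prime_mul_log_sub_integral_le hea hab hf hf'c hE
  -- the prime sum is the prime count
  have hsum : ∑ p ∈ (Finset.Ioc ⌊a⌋₊ ⌊b⌋₊).filter Nat.Prime, f p * Real.log p =
      (((Finset.Ioc ⌊a⌋₊ ⌊b⌋₊).filter Nat.Prime).card : ℝ) := by
    rw [Finset.card_eq_sum_ones, Nat.cast_sum]
    refine Finset.sum_congr rfl fun p hp => ?_
    have hp2 := (Finset.mem_filter.mp hp).2.two_le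
    have hlp : Real.log p ≠ 0 := (Real.log_pos (by exact_mod_cast hp2)).ne'
    rw [hf_def]
    simp [hlp]
  -- integration by parts for `∫ dt/log t`
  have huIcc : uIcc a b = Icc a b := uIcc_of_le hab
  have hf'_ii : IntervalIntegrable f' volume a b := (hf'c.mono huIcc.subset).intervalIntegrable
  have hIBP : ∫ t in a..b, f t = b / Real.log b - a / Real.log a + ∫ t in a..b, (Real.log t ^ 2)⁻¹ := by
    have h := intervalIntegral.integral_mul_deriv_eq_deriv_mul (u := f) (v := id) (u' := f')
      (v' := fun _ => (1 : ℝ)) (fun t ht => hf t (huIcc ▸ ht)) (fun t _ => hasDerivAt_id t)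
      hf'_ii intervalIntegrable_const
    simp only [id, mul_one] at h
    rw [h, hf_def, hf'_def]
    simp only
    have hcongr : ∫ t in a..b, -t⁻¹ / Real.log t ^ 2 * t = ∫ t in a..b, -(Real.log t ^ 2)⁻¹ := by
      refine intervalIntegral.integral_congr fun t ht => ?_
      have ht0 : t ≠ 0 := (hmem t (huIcc ▸ ht)).1.ne'
      field_simp
    rw [hcongr, intervalIntegral.integral_neg]
    simp only [div_eq_mul_inv]
    ring
  -- `0 ≤ ∫ dt/log² t ≤ b/log² a`
  have hsq_cont : ContinuousOn (fun t : ℝ => (Real.log t ^ 2)⁻¹) (Icc a b) := fun t ht => by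
    obtain ⟨ht0, hlt⟩ := hmem t ht
    have h1 : t ≠ 0 := ht0.ne'
    have h2 : Real.log t ^ 2 ≠ 0 := pow_ne_zero 2 (by linarith)
    refine ContinuousAt.continuousWithinAt ?_
    fun_prop (disch := assumption)
  have hsq_ii : IntervalIntegrable (fun t : ℝ => (Real.log t ^ 2)⁻¹) volume a b :=
    (hsq_cont.mono huIcc.subset).intervalIntegrable
  have hI0 : 0 ≤ ∫ t in a..b, (Real.log t ^ 2)⁻¹ :=
    intervalIntegral.integral_nonneg hab fun t ht => by positivity
  have hI1 : ∫ t in a..b, (Real.log t ^ 2)⁻¹ ≤ b / Real.log a ^ 2 := by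
    calc ∫ t in a..b, (Real.log t ^ 2)⁻¹ ≤ ∫ _ in a..b, (Real.log a ^ 2)⁻¹ := by
          refine intervalIntegral.integral_mono_on hab hsq_ii intervalIntegrable_const fun t ht => ?_
          obtain ⟨ht0, hlt⟩ := hmem t ht
          have hlog : Real.log a ≤ Real.log t := Real.log_le_log ha0 ht.1
          gcongr
      _ = (b - a) * (Real.log a ^ 2)⁻¹ := by rw [intervalIntegral.integral_const, smul_eq_mul]
      _ ≤ b / Real.log a ^ 2 := by
          rw [div_eq_mul_inv]
          exact mul_le_mul_of_nonneg_right (by linarith) (by positivity)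
  -- the three error terms are each `≤ C b/log³ a ≤ C b/log² a`
  have hb0 : 0 < b := ha0.trans_le hab
  have hlb : 1 ≤ Real.log b := hla.trans (Real.log_le_log ha0 hab)
  have hlab : Real.log a ≤ Real.log b := Real.log_le_log ha0 hab
  have hT1 : |f b| * (C * b / Real.log b ^ 2) ≤ C * b / Real.log a ^ 2 := by
    rw [hf_def]
    simp only
    rw [abs_of_pos (by positivity)]
    calc (Real.log b)⁻¹ * (C * b / Real.log b ^ 2) ≤ 1 * (C * b / Real.log a ^ 2) := by
          gcongr
          exact inv_le_one_of_one_le₀ hlb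
      _ = _ := one_mul _
  have hT2 : |f a| * (C * a / Real.log a ^ 2) ≤ C * b / Real.log a ^ 2 := by
    rw [hf_def]
    simp only
    rw [abs_of_pos (by positivity)]
    calc (Real.log a)⁻¹ * (C * a / Real.log a ^ 2) ≤ 1 * (C * b / Real.log a ^ 2) := by
          gcongr
          exact inv_le_one_of_one_le₀ hla
      _ = _ := one_mul _
  have hT3 : ∫ t in a..b, |f' t| * (C * t / Real.log t ^ 2) ≤ C * b / Real.log a ^ 2 := by
    have hpt : ∀ t ∈ Icc a b, |f' t| * (C * t / Real.log t ^ 2) ≤ C / Real.log a ^ 2 := by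
      intro t ht
      obtain ⟨ht0, hlt⟩ := hmem t ht
      have hlat : Real.log a ≤ Real.log t := Real.log_le_log ha0 ht.1
      rw [hf'_def]
      simp only
      rw [neg_div, abs_neg, abs_of_pos (by positivity)]
      calc t⁻¹ / Real.log t ^ 2 * (C * t / Real.log t ^ 2) = C / Real.log t ^ 2 * (Real.log t ^ 2)⁻¹ := by
            field_simp
        _ ≤ C / Real.log a ^ 2 * 1 := by
            gcongr
            exact inv_le_one_of_one_le₀ (by nlinarith)
        _ = C / Real.log a ^ 2 := mul_one _
    have hcont : ContinuousOn (fun t => |f' t| * (C * t / Real.log t ^ 2)) (Icc a b) := by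
      refine (continuous_abs.comp_continuousOn hf'c).mul fun t ht => ?_
      obtain ⟨ht0, hlt⟩ := hmem t ht
      have h1 : t ≠ 0 := ht0.ne'
      have h2 : Real.log t ^ 2 ≠ 0 := pow_ne_zero 2 (by linarith)
      refine ContinuousAt.continuousWithinAt ?_
      fun_prop (disch := assumption)
    calc ∫ t in a..b, |f' t| * (C * t / Real.log t ^ 2) ≤ ∫ _ in a..b, C / Real.log a ^ 2 :=
          intervalIntegral.integral_mono_on hab (hcont.mono huIcc.subset).intervalIntegrable
            intervalIntegrable_const hpt
      _ = (b - a) * (C / Real.log a ^ 2) := by rw [intervalIntegral.integral_const, smul_eq_mul]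
      _ ≤ b * (C / Real.log a ^ 2) := mul_le_mul_of_nonneg_right (by linarith) (by positivity)
      _ = C * b / Real.log a ^ 2 := by ring
  rw [hsum, hIBP] at hmain
  have key : |((((Finset.Ioc ⌊a⌋₊ ⌊b⌋₊).filter Nat.Prime).card : ℝ)) -
      (b / Real.log b - a / Real.log a)| ≤
      b / Real.log a ^ 2 + 3 * (C * b / Real.log a ^ 2) := by
    have h := abs_sub_le (((Finset.Ioc ⌊a⌋₊ ⌊b⌋₊).filter Nat.Prime).card : ℝ)
      (b / Real.log b - a / Real.log a + ∫ t in a..b, (Real.log t ^ 2)⁻¹)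
      (b / Real.log b - a / Real.log a)
    have h2 : |b / Real.log b - a / Real.log a + (∫ t in a..b, (Real.log t ^ 2)⁻¹) -
        (b / Real.log b - a / Real.log a)| ≤ b / Real.log a ^ 2 := by
      rw [add_sub_cancel_left, abs_of_nonneg hI0]; exact hI1
    linarith
  calc _ ≤ b / Real.log a ^ 2 + 3 * (C * b / Real.log a ^ 2) := key
    _ = (1 + 3 * C) * b / Real.log a ^ 2 := by ring


/-- **`∑_{⌊a⌋ < p ≤ ⌊b⌋} 1/p ≤ (1 + 2C) log b/log a + 2C`** (`e ≤ a ≤ b`; weight `1/(t log t)`,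
`∫_a^b dt/(t log t) ≤ log(b/a)/log a`). [cite: MontgomeryVaughan2007, §2.1 (Abel summation)] -/
theorem sum_primes_Ioc_inv_le (ha : Real.exp 1 ≤ a) (hab : a ≤ b) (hC : 0 ≤ C)
    (hE : ∀ t : ℝ, 2 ≤ t → |θ t - t| ≤ C * t / Real.log t ^ 2) :
    ∑ p ∈ (Finset.Ioc ⌊a⌋₊ ⌊b⌋₊).filter Nat.Prime, (p : ℝ)⁻¹ ≤
      (1 + 2 * C) * (Real.log b / Real.log a) + 2 * C := by
  have hea : (2 : ℝ) ≤ a := le_trans (by have := Real.add_one_le_exp (1 : ℝ); linarith) ha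
  obtain ⟨ha0, hla⟩ := pos_and_one_le_log ha
  have hmem : ∀ t ∈ Icc a b, 0 < t ∧ 1 ≤ Real.log t := fun t ht =>
    pos_and_one_le_log (ha.trans ht.1)
  have hb0 : 0 < b := ha0.trans_le hab
  have hlab : Real.log a ≤ Real.log b := Real.log_le_log ha0 hab
  have hlb : 1 ≤ Real.log b := hla.trans hlab
  set f : ℝ → ℝ := fun t => (t * Real.log t)⁻¹ with hf_def
  set f' : ℝ → ℝ := fun t => -(Real.log t + 1) / (t * Real.log t) ^ 2 with hf'_def
  have hf : ∀ t ∈ Icc a b, HasDerivAt f (f' t) t := fun t ht => by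
    obtain ⟨ht0, hlt⟩ := hmem t ht
    have h := ((hasDerivAt_id' t).fun_mul (Real.hasDerivAt_log ht0.ne')).fun_inv
      (mul_ne_zero ht0.ne' (by linarith))
    refine h.congr_deriv ?_
    rw [hf'_def]
    simp only
    rw [mul_inv_cancel₀ ht0.ne']
    ring
  have hf'c : ContinuousOn f' (Icc a b) := fun t ht => by
    obtain ⟨ht0, hlt⟩ := hmem t ht
    have h1 : t ≠ 0 := ht0.ne'
    have h2 : (t * Real.log t) ^ 2 ≠ 0 := pow_ne_zero 2 (mul_ne_zero h1 (by linarith))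
    refine ContinuousAt.continuousWithinAt ?_
    rw [hf'_def]
    fun_prop (disch := assumption)
  have hmain := abs_sum_prime_mul_log_sub_integral_le hea hab hf hf'c hE
  have hsum : ∑ p ∈ (Finset.Ioc ⌊a⌋₊ ⌊b⌋₊).filter Nat.Prime, f p * Real.log p =
      ∑ p ∈ (Finset.Ioc ⌊a⌋₊ ⌊b⌋₊).filter Nat.Prime, (p : ℝ)⁻¹ := by
    refine Finset.sum_congr rfl fun p hp => ?_
    have hp2 := (Finset.mem_filter.mp hp).2.two_le
    have hp0 : (p : ℝ) ≠ 0 := by positivity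
    have hlp : Real.log p ≠ 0 := (Real.log_pos (by exact_mod_cast hp2)).ne'
    rw [hf_def]
    field_simp
  have huIcc : uIcc a b = Icc a b := uIcc_of_le hab
  -- main term `∫ dt/(t log t) ≤ log(b/a)/log a ≤ log b/log a`
  have hfc : ContinuousOn f (Icc a b) := fun t ht => by
    obtain ⟨ht0, hlt⟩ := hmem t ht
    have h1 : t ≠ 0 := ht0.ne'
    have h2 : t * Real.log t ≠ 0 := mul_ne_zero h1 (by linarith)
    refine ContinuousAt.continuousWithinAt ?_
    rw [hf_def]
    fun_prop (disch := assumption)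
  have hI : ∫ t in a..b, f t ≤ Real.log b / Real.log a := by
    calc ∫ t in a..b, f t ≤ ∫ t in a..b, (Real.log a)⁻¹ * t⁻¹ := by
          refine intervalIntegral.integral_mono_on hab (hfc.mono huIcc.subset).intervalIntegrable
            ?_ fun t ht => ?_
          · refine ((continuousOn_const.mul (continuousOn_inv₀.mono ?_)).mono huIcc.subset).intervalIntegrable
            intro t ht; exact ne_of_gt (hmem t ht).1
          · obtain ⟨ht0, hlt⟩ := hmem t ht
            have hlat : Real.log a ≤ Real.log t := Real.log_le_log ha0 ht.1
            rw [hf_def]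
            simp only
            rw [mul_inv, mul_comm]
            gcongr
      _ = (Real.log a)⁻¹ * Real.log (b / a) := by
          rw [intervalIntegral.integral_const_mul, integral_inv_of_pos ha0 hb0]
      _ ≤ (Real.log a)⁻¹ * Real.log b := by
          refine mul_le_mul_of_nonneg_left ?_ (by positivity)
          rw [Real.log_div hb0.ne' ha0.ne']; linarith
      _ = Real.log b / Real.log a := by rw [inv_mul_eq_div]
  -- error terms
  have hT1 : |f b| * (C * b / Real.log b ^ 2) ≤ C := by
    rw [hf_def]
    simp only
    rw [abs_of_pos (by positivity)]
    calc (b * Real.log b)⁻¹ * (C * b / Real.log b ^ 2) = C * (Real.log b ^ 3)⁻¹ := by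
          field_simp
      _ ≤ C * 1 := by gcongr; exact inv_le_one_of_one_le₀ (one_le_pow₀ hlb)
      _ = C := mul_one _
  have hT2 : |f a| * (C * a / Real.log a ^ 2) ≤ C := by
    rw [hf_def]
    simp only
    rw [abs_of_pos (by positivity)]
    calc (a * Real.log a)⁻¹ * (C * a / Real.log a ^ 2) = C * (Real.log a ^ 3)⁻¹ := by
          field_simp
      _ ≤ C * 1 := by gcongr; exact inv_le_one_of_one_le₀ (one_le_pow₀ hla)
      _ = C := mul_one _
  have hT3 : ∫ t in a..b, |f' t| * (C * t / Real.log t ^ 2) ≤ 2 * C * (Real.log b / Real.log a) := by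
    have hpt : ∀ t ∈ Icc a b, |f' t| * (C * t / Real.log t ^ 2) ≤ 2 * C * (Real.log a)⁻¹ * t⁻¹ := by
      intro t ht
      obtain ⟨ht0, hlt⟩ := hmem t ht
      have hlat : Real.log a ≤ Real.log t := Real.log_le_log ha0 ht.1
      rw [hf'_def]
      simp only
      rw [neg_div, abs_neg, abs_of_pos (by positivity)]
      -- `(log t + 1)/(t log t)² · C t/log² t = C (log t + 1)/(t log⁴ t) ≤ 2C/(t log³ t) ≤ 2C/(t log a)`
      rw [div_mul_div_comm, div_le_iff₀ (by positivity)]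
      have h1 : Real.log t + 1 ≤ 2 * Real.log t := by linarith
      have hlt2 : 1 ≤ Real.log t ^ 2 := one_le_pow₀ hlt
      have h2 : Real.log a ≤ Real.log t ^ 3 := by
        calc Real.log a ≤ Real.log t := hlat
          _ = Real.log t * 1 := (mul_one _).symm
          _ ≤ Real.log t * Real.log t ^ 2 := by gcongr
          _ = Real.log t ^ 3 := by ring
      have hla0 : Real.log a ≠ 0 := ne_of_gt (by linarith)
      have ht0' : t ≠ 0 := ht0.ne'
      have key : (Real.log t + 1) * (C * t) * Real.log a ≤ 2 * C * t * Real.log t ^ 4 := by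
        calc (Real.log t + 1) * (C * t) * Real.log a ≤ 2 * Real.log t * (C * t) * Real.log a := by
              gcongr
          _ = 2 * C * t * (Real.log t * Real.log a) := by ring
          _ ≤ 2 * C * t * (Real.log t * Real.log t ^ 3) := by gcongr
          _ = 2 * C * t * Real.log t ^ 4 := by ring
      rw [show 2 * C * (Real.log a)⁻¹ * t⁻¹ * ((t * Real.log t) ^ 2 * Real.log t ^ 2) =
        2 * C * t * Real.log t ^ 4 / Real.log a by field_simp]
      rwa [le_div_iff₀ (by linarith)]
    have hcont : ContinuousOn (fun t => |f' t| * (C * t / Real.log t ^ 2)) (Icc a b) := by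
      refine (continuous_abs.comp_continuousOn hf'c).mul fun t ht => ?_
      obtain ⟨ht0, hlt⟩ := hmem t ht
      have h1 : t ≠ 0 := ht0.ne'
      have h2 : Real.log t ^ 2 ≠ 0 := pow_ne_zero 2 (by linarith)
      refine ContinuousAt.continuousWithinAt ?_
      fun_prop (disch := assumption)
    have hcont2 : ContinuousOn (fun t : ℝ => 2 * C * (Real.log a)⁻¹ * t⁻¹) (Icc a b) :=
      continuousOn_const.mul (continuousOn_inv₀.mono fun t ht => ne_of_gt (hmem t ht).1)
    calc ∫ t in a..b, |f' t| * (C * t / Real.log t ^ 2) ≤ ∫ t in a..b, 2 * C * (Real.log a)⁻¹ * t⁻¹ :=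
          intervalIntegral.integral_mono_on hab (hcont.mono huIcc.subset).intervalIntegrable
            (hcont2.mono huIcc.subset).intervalIntegrable hpt
      _ = 2 * C * (Real.log a)⁻¹ * Real.log (b / a) := by
          rw [intervalIntegral.integral_const_mul, integral_inv_of_pos ha0 hb0]
      _ ≤ 2 * C * (Real.log a)⁻¹ * Real.log b := by
          refine mul_le_mul_of_nonneg_left ?_ (by positivity)
          rw [Real.log_div hb0.ne' ha0.ne']; linarith
      _ = 2 * C * (Real.log b / Real.log a) := by ring
  rw [hsum] at hmain
  have h := abs_sub_le_iff.mp hmain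
  nlinarith [h.1, hI, hT1, hT2, hT3]

/-- **`∑_{⌊a⌋ < p ≤ ⌊b⌋} p/log p ≤ (1 + 5C) b²/log² a`** (`e ≤ a ≤ b`; weight `t/log² t`,
`∫_a^b t dt/log² t ≤ b²/log² a`). [cite: MontgomeryVaughan2007, §2.1 (Abel summation)] -/
theorem sum_primes_Ioc_div_log_le (ha : Real.exp 1 ≤ a) (hab : a ≤ b) (hC : 0 ≤ C)
    (hE : ∀ t : ℝ, 2 ≤ t → |θ t - t| ≤ C * t / Real.log t ^ 2) :
    ∑ p ∈ (Finset.Ioc ⌊a⌋₊ ⌊b⌋₊).filter Nat.Prime, (p : ℝ) / Real.log p ≤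
      (1 + 5 * C) * b ^ 2 / Real.log a ^ 2 := by
  have hea : (2 : ℝ) ≤ a := le_trans (by have := Real.add_one_le_exp (1 : ℝ); linarith) ha
  obtain ⟨ha0, hla⟩ := pos_and_one_le_log ha
  have hmem : ∀ t ∈ Icc a b, 0 < t ∧ 1 ≤ Real.log t := fun t ht =>
    pos_and_one_le_log (ha.trans ht.1)
  have hb0 : 0 < b := ha0.trans_le hab
  have hlab : Real.log a ≤ Real.log b := Real.log_le_log ha0 hab
  have hlb : 1 ≤ Real.log b := hla.trans hlab
  set f : ℝ → ℝ := fun t => t / Real.log t ^ 2 with hf_def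
  set f' : ℝ → ℝ := fun t => (Real.log t - 2) / Real.log t ^ 3 with hf'_def
  have hf : ∀ t ∈ Icc a b, HasDerivAt f (f' t) t := fun t ht => by
    obtain ⟨ht0, hlt⟩ := hmem t ht
    have hl0 : Real.log t ≠ 0 := by linarith
    have h := (hasDerivAt_id' t).fun_div ((Real.hasDerivAt_log ht0.ne').fun_pow 2)
      (pow_ne_zero 2 hl0)
    refine h.congr_deriv ?_
    rw [hf'_def]
    simp only [Nat.cast_ofNat]
    rw [show (2 : ℕ) - 1 = 1 from rfl, pow_one, div_eq_div_iff (by positivity) (by positivity)]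
    field_simp
  have hf'c : ContinuousOn f' (Icc a b) := fun t ht => by
    obtain ⟨ht0, hlt⟩ := hmem t ht
    have h1 : t ≠ 0 := ht0.ne'
    have h2 : Real.log t ^ 3 ≠ 0 := pow_ne_zero 3 (by linarith)
    refine ContinuousAt.continuousWithinAt ?_
    rw [hf'_def]
    fun_prop (disch := assumption)
  have hmain := abs_sum_prime_mul_log_sub_integral_le hea hab hf hf'c hE
  have hsum : ∑ p ∈ (Finset.Ioc ⌊a⌋₊ ⌊b⌋₊).filter Nat.Prime, f p * Real.log p =
      ∑ p ∈ (Finset.Ioc ⌊a⌋₊ ⌊b⌋₊).filter Nat.Prime, (p : ℝ) / Real.log p := by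
    refine Finset.sum_congr rfl fun p hp => ?_
    have hp2 := (Finset.mem_filter.mp hp).2.two_le
    have hlp : Real.log p ≠ 0 := (Real.log_pos (by exact_mod_cast hp2)).ne'
    rw [hf_def]
    field_simp
  have huIcc : uIcc a b = Icc a b := uIcc_of_le hab
  have hfc : ContinuousOn f (Icc a b) := fun t ht => by
    obtain ⟨ht0, hlt⟩ := hmem t ht
    have h2 : Real.log t ^ 2 ≠ 0 := pow_ne_zero 2 (by linarith)
    have h1 : t ≠ 0 := ht0.ne'
    refine ContinuousAt.continuousWithinAt ?_
    rw [hf_def]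
    fun_prop (disch := assumption)
  have hB : 0 ≤ b ^ 2 / Real.log a ^ 2 := by positivity
  -- main term
  have hI : ∫ t in a..b, f t ≤ b ^ 2 / Real.log a ^ 2 := by
    calc ∫ t in a..b, f t ≤ ∫ _ in a..b, b / Real.log a ^ 2 := by
          refine intervalIntegral.integral_mono_on hab (hfc.mono huIcc.subset).intervalIntegrable
            intervalIntegrable_const fun t ht => ?_
          obtain ⟨ht0, hlt⟩ := hmem t ht
          have hlat : Real.log a ≤ Real.log t := Real.log_le_log ha0 ht.1
          rw [hf_def]
          simp only
          gcongr
          exact ht.2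
      _ = (b - a) * (b / Real.log a ^ 2) := by rw [intervalIntegral.integral_const, smul_eq_mul]
      _ ≤ b * (b / Real.log a ^ 2) := mul_le_mul_of_nonneg_right (by linarith) (by positivity)
      _ = b ^ 2 / Real.log a ^ 2 := by ring
  -- error terms
  have hT1 : |f b| * (C * b / Real.log b ^ 2) ≤ C * (b ^ 2 / Real.log a ^ 2) := by
    rw [hf_def]
    simp only
    rw [abs_of_pos (by positivity)]
    calc b / Real.log b ^ 2 * (C * b / Real.log b ^ 2) = C * (b ^ 2 / Real.log b ^ 2) * (Real.log b ^ 2)⁻¹ := by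
          field_simp
      _ ≤ C * (b ^ 2 / Real.log a ^ 2) * 1 := by
          gcongr
          exact inv_le_one_of_one_le₀ (one_le_pow₀ hlb)
      _ = _ := mul_one _
  have hT2 : |f a| * (C * a / Real.log a ^ 2) ≤ C * (b ^ 2 / Real.log a ^ 2) := by
    rw [hf_def]
    simp only
    rw [abs_of_pos (by positivity)]
    calc a / Real.log a ^ 2 * (C * a / Real.log a ^ 2) = C * (a ^ 2 / Real.log a ^ 2) * (Real.log a ^ 2)⁻¹ := by
          field_simp
      _ ≤ C * (b ^ 2 / Real.log a ^ 2) * 1 := by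
          gcongr
          exact inv_le_one_of_one_le₀ (one_le_pow₀ hla)
      _ = _ := mul_one _
  have hT3 : ∫ t in a..b, |f' t| * (C * t / Real.log t ^ 2) ≤ 3 * C * (b ^ 2 / Real.log a ^ 2) := by
    have hpt : ∀ t ∈ Icc a b, |f' t| * (C * t / Real.log t ^ 2) ≤ 3 * C * b / Real.log a ^ 2 := by
      intro t ht
      obtain ⟨ht0, hlt⟩ := hmem t ht
      have hlat : Real.log a ≤ Real.log t := Real.log_le_log ha0 ht.1
      have habs : |f' t| ≤ 3 := by
        rw [hf'_def]
        simp only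
        rw [abs_div, abs_of_pos (by positivity : (0 : ℝ) < Real.log t ^ 3), div_le_iff₀ (by positivity)]
        have h4 : Real.log t ≤ Real.log t ^ 3 := by
          calc Real.log t = Real.log t * 1 := (mul_one _).symm
            _ ≤ Real.log t * Real.log t ^ 2 := by gcongr; exact one_le_pow₀ hlt
            _ = Real.log t ^ 3 := by ring
        calc |Real.log t - 2| ≤ |Real.log t| + |(2 : ℝ)| := abs_sub _ _
          _ = Real.log t + 2 := by rw [abs_of_pos (by linarith), abs_of_pos (by norm_num)]
          _ ≤ 3 * Real.log t ^ 3 := by linarith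
      calc |f' t| * (C * t / Real.log t ^ 2) ≤ 3 * (C * b / Real.log a ^ 2) := by
            gcongr
            exact ht.2
        _ = 3 * C * b / Real.log a ^ 2 := by ring
    have hcont : ContinuousOn (fun t => |f' t| * (C * t / Real.log t ^ 2)) (Icc a b) := by
      refine (continuous_abs.comp_continuousOn hf'c).mul fun t ht => ?_
      obtain ⟨ht0, hlt⟩ := hmem t ht
      have h1 : t ≠ 0 := ht0.ne'
      have h2 : Real.log t ^ 2 ≠ 0 := pow_ne_zero 2 (by linarith)
      refine ContinuousAt.continuousWithinAt ?_
      fun_prop (disch := assumption)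
    calc ∫ t in a..b, |f' t| * (C * t / Real.log t ^ 2) ≤ ∫ _ in a..b, 3 * C * b / Real.log a ^ 2 :=
          intervalIntegral.integral_mono_on hab (hcont.mono huIcc.subset).intervalIntegrable
            intervalIntegrable_const hpt
      _ = (b - a) * (3 * C * b / Real.log a ^ 2) := by
          rw [intervalIntegral.integral_const, smul_eq_mul]
      _ ≤ b * (3 * C * b / Real.log a ^ 2) := mul_le_mul_of_nonneg_right (by linarith) (by positivity)
      _ = 3 * C * (b ^ 2 / Real.log a ^ 2) := by ring
  rw [hsum] at hmain
  have h := abs_sub_le_iff.mp hmain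
  have : ∑ p ∈ (Finset.Ioc ⌊a⌋₊ ⌊b⌋₊).filter Nat.Prime, (p : ℝ) / Real.log p ≤
      (1 + 5 * C) * (b ^ 2 / Real.log a ^ 2) := by nlinarith [h.1, hI, hT1, hT2, hT3]
  calc _ ≤ (1 + 5 * C) * (b ^ 2 / Real.log a ^ 2) := this
    _ = (1 + 5 * C) * b ^ 2 / Real.log a ^ 2 := by ring

end Weights

end Literature.NumberTheory.LFunctions
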